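import Mathlib
import Literature.Computability.Complexity.CircuitClasses
import Literature.Computability.MetaComplexity.FormulaModelsAE
import HarnessLib

/-!
# Deterministic branching programs and the almost-everywhere size class `BPSIZEae`

Definitions only (census cell `pub-magnif`, definition item D6), for the branching-program items of
Oliveira–Pich–Santhanam (ToC 2021) Thm 1.1(7) / Thm 1.2(3) and Hirahara's read-once variants.

Literature: I. Wegener, *Branching Programs and Binary Decision Diagrams*, SIAM 2000, Def. 1.1.1
(a branching program on `x₁,…,xₙ` is a directed acyclic graph with one source, inner nodes labelled by
variables with two outgoing edges labelled `0`/`1`, and sinks labelled by constants; the computation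
path from the source follows the edge labelled `x_i` at a node labelled `x_i`; SIZE = number of
(inner) nodes); S. Jukna, *Boolean Function Complexity*, Springer 2012, §1.2 (same); OPS 2021, p. 4:
"BP[s] denotes deterministic branching programs of size at most s".

## Rendering

* `BranchingProgram n`: finitely many inner nodes `Fin m`, each with a queried variable `var v : Fin n`
  and two successors `next v b : Fin m ⊕ Bool` (an inner node or a sink value), a start `Fin m ⊕ Bool`
  (a program may be a bare sink), and a RANK function strictly decreasing along edges (acyclicity —
  without it the object would not be a DAG and "size" would not mean what print means).
* Evaluation follows the computation path; it is implemented with fuel `rank + 1`, which suffices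
  because the rank strictly decreases at every step (`evalFrom_eq_of_le` shows the value is
  fuel-independent once the fuel exceeds the rank), so `eval` IS the computation-path semantics.
* `size` = number of inner nodes (`m`; Wegener). Counting sinks too, or edges, changes sizes by `+2`
  or a factor `≤ 2`; every fact typed over `BPSIZEae` below is stated with `∀ ε ∃ δ`-room and in
  tail form, which absorbs such constant discrepancies (documented at the facts).
* `BPSIZEae s`: languages decided at every length by a family of branching programs whose size is
  `≤ s n` at all sufficiently large `n` (almost-everywhere, like `SIZEae`/`FORMULAae` of
  `FormulaModelsAE.lean`); inhabited as soon as `s ≥ 1` eventually (`headLang_mem_BPSIZEae`,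
  referee rule F1), and closed under eventual modification of the bound (`BPSIZEae_mono`).
-/

namespace Literature.Computability.MetaComplexity

open Literature.Computability.Complexity

/-- A deterministic **branching program** on `n` Boolean variables (Wegener 2000, Def. 1.1.1):
`m` inner nodes, each querying a variable and branching to an inner node or to a sink value; a start
node or start sink; and a rank certifying acyclicity. [cite: Wegener2000, Def. 1.1.1] -/
structure BranchingProgram (n : ℕ) where
  /-- Number of inner (non-sink) nodes. -/
  m : ℕ
  /-- The variable queried at an inner node. -/
  var : Fin m → Fin n
  /-- The successor along the edge labelled `b`: an inner node or a sink carrying an output value. -/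
  next : Fin m → Bool → Fin m ⊕ Bool
  /-- The source: an inner node, or a sink (constant program). -/
  start : Fin m ⊕ Bool
  /-- A rank function, strictly decreasing along edges (acyclicity). -/
  rank : Fin m → ℕ
  /-- Edges go down in rank. -/
  rank_lt : ∀ (v : Fin m) (b : Bool) (w : Fin m), next v b = Sum.inl w → rank w < rank v

namespace BranchingProgram

variable {n : ℕ}

/-- The SIZE of a branching program: its number of inner nodes. [cite: Wegener2000, Def. 1.1.1] -/
def size (P : BranchingProgram n) : ℕ := P.m

/-- Follow the computation path from position `s` with `fuel` steps available; a sink returns its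
value, an inner node queries its variable and moves on; out of fuel returns `false` (never reached
with fuel `> rank`, see `evalFrom_eq_of_le`). [cite: Wegener2000, Def. 1.1.1] -/
def evalFrom (P : BranchingProgram n) (x : Fin n → Bool) : ℕ → (Fin P.m ⊕ Bool) → Bool
  | _, Sum.inr b => b
  | 0, Sum.inl _ => false
  | fuel + 1, Sum.inl v => P.evalFrom x fuel (P.next v (x (P.var v)))

/-- The canonical fuel for a position: `rank + 1` for an inner node, `0` for a sink. [folklore] -/
def fuelOf (P : BranchingProgram n) : (Fin P.m ⊕ Bool) → ℕ
  | Sum.inl v => P.rank v + 1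
  | Sum.inr _ => 0

/-- **Evaluation** of a branching program on an input: the value of the sink reached by the
computation path from the start. [cite: Wegener2000, Def. 1.1.1] -/
def eval (P : BranchingProgram n) (x : Fin n → Bool) : Bool :=
  P.evalFrom x (P.fuelOf P.start) P.start

/-- A sink returns its value. [folklore] -/
@[simp] theorem evalFrom_inr (P : BranchingProgram n) (x : Fin n → Bool) (fuel : ℕ) (b : Bool) :
    P.evalFrom x fuel (Sum.inr b) = b := by
  cases fuel <;> rfl

/-- An inner node queries its variable and moves to the successor. [folklore] -/
@[simp] theorem evalFrom_succ_inl (P : BranchingProgram n) (x : Fin n → Bool) (fuel : ℕ)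
    (v : Fin P.m) :
    P.evalFrom x (fuel + 1) (Sum.inl v) = P.evalFrom x fuel (P.next v (x (P.var v))) := rfl

/-- **Fuel independence**: any fuel exceeding the rank of the current inner node gives the same
value as the canonical fuel — so `eval` is the computation-path semantics. [folklore] -/
theorem evalFrom_eq_of_le (P : BranchingProgram n) (x : Fin n → Bool) :
    ∀ (fuel : ℕ) (s : Fin P.m ⊕ Bool), P.fuelOf s ≤ fuel →
      P.evalFrom x fuel s = P.evalFrom x (P.fuelOf s) s := by
  intro fuel
  induction fuel using Nat.strong_induction_on with
  | _ fuel ih =>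
    intro s hs
    match s, fuel, hs with
    | Sum.inr b, fuel, _ => simp
    | Sum.inl v, 0, hs => simp [fuelOf] at hs
    | Sum.inl v, fuel + 1, hs =>
      simp only [fuelOf, evalFrom_succ_inl] at hs ⊢
      have hfuel : P.rank v ≤ fuel := by omega
      -- both sides continue from the successor
      set s' := P.next v (x (P.var v)) with hs'
      have hle : P.fuelOf s' ≤ P.rank v := by
        rcases h : s' with w | b
        · have := P.rank_lt v (x (P.var v)) w (by rw [← hs', h])
          simp [fuelOf]; omega
        · simp [fuelOf]
      rw [ih fuel (by omega) s' (hle.trans hfuel), ih (P.rank v) (by omega) s' hle]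

/-! ### Constant and one-query programs (non-vacuity) -/

/-- The constant program (a bare sink). [folklore] -/
def const (n : ℕ) (b : Bool) : BranchingProgram n where
  m := 0
  var := Fin.elim0
  next := Fin.elim0
  start := Sum.inr b
  rank := Fin.elim0
  rank_lt := fun v => Fin.elim0 v

/-- The constant program has no inner nodes. [folklore] -/
@[simp] theorem size_const (n : ℕ) (b : Bool) : (const n b).size = 0 := rfl

/-- The constant program computes the constant. [folklore] -/
@[simp] theorem eval_const (n : ℕ) (b : Bool) (x : Fin n → Bool) : (const n b).eval x = b := rfl

/-- The one-node program reading variable `i` and outputting its value. [folklore] -/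
def query (i : Fin n) : BranchingProgram n where
  m := 1
  var := fun _ => i
  next := fun _ b => Sum.inr b
  start := Sum.inl 0
  rank := fun _ => 0
  rank_lt := fun v b w h => by simp at h

/-- The query program has one inner node. [folklore] -/
@[simp] theorem size_query (i : Fin n) : (query i).size = 1 := rfl

/-- The query program computes the projection. [folklore] -/
@[simp] theorem eval_query (i : Fin n) (x : Fin n → Bool) : (query i).eval x = x i := by
  simp [eval, query, fuelOf, evalFrom]

end BranchingProgram

/-! ### The almost-everywhere size class -/

/-- A family of branching programs, one per input length. [folklore] -/
def BPFamily : Type := ∀ n : ℕ, BranchingProgram n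

/-- `P.Decides L`: at every length the program computes the indicator of `L`. [folklore] -/
noncomputable def BPFamily.Decides (P : BPFamily) (L : Language Bool) : Prop :=
  ∀ x : List Bool, (P x.length).eval x.get = L.boolIndicator x

/-- **`BPSIZEae s`** (`BP[s]` of OPS 2021, p. 4, read almost everywhere): languages decided by a family
of deterministic branching programs of size (inner nodes) `≤ s n` at every sufficiently large length.
[cite: OliveiraPichSanthanam2021, §1.2 (Notation, p. 4: BP[s])] -/
def BPSIZEae (s : ℕ → ℕ) : Set (Language Bool) :=
  {L | ∃ P : BPFamily, (∃ n₀ : ℕ, ∀ n ≥ n₀, (P n).size ≤ s n) ∧ P.Decides L}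

/-- `BPSIZEae` is monotone under eventual domination of the size bound. [folklore] -/
theorem BPSIZEae_mono {s s' : ℕ → ℕ} (h : ∃ n₁ : ℕ, ∀ n ≥ n₁, s n ≤ s' n) :
    BPSIZEae s ⊆ BPSIZEae s' := by
  rintro L ⟨P, ⟨n₀, hn₀⟩, hP⟩
  obtain ⟨n₁, hn₁⟩ := h
  exact ⟨P, ⟨max n₀ n₁, fun n hn =>
    (hn₀ n (le_of_max_le_left hn)).trans (hn₁ n (le_of_max_le_right hn))⟩, hP⟩

/-- The family deciding `headLang` (first bit is `1`): the constant-`false` sink at length `0`, the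
one-node query of variable `0` at positive lengths. [folklore] -/
def headBPFamily : BPFamily := fun n =>
  match n with
  | 0 => BranchingProgram.const 0 false
  | k + 1 => BranchingProgram.query (0 : Fin (k + 1))

/-- The `headLang` family has size `≤ 1`. [folklore] -/
theorem headBPFamily_size_le (n : ℕ) : (headBPFamily n).size ≤ 1 := by
  cases n <;> simp [headBPFamily]

/-- The `headLang` family decides `headLang`. [folklore] -/
theorem headBPFamily_decides : headBPFamily.Decides headLang := by
  intro x
  cases x with
  | nil =>
    have hnot : ([] : List Bool) ∉ headLang := fun ⟨h, _⟩ => by simp at h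
    exact ((Set.notMem_iff_boolIndicator _ _).1 hnot).symm
  | cons b xs =>
    have hmem : (b :: xs) ∈ headLang ↔ b = true := by
      constructor
      · rintro ⟨h, hb⟩; simpa using hb
      · intro hb; exact ⟨by simp, by simpa using hb⟩
    change (BranchingProgram.query (0 : Fin (xs.length + 1))).eval (b :: xs).get = _
    rw [BranchingProgram.eval_query]
    change b = _
    cases b with
    | true => exact ((Set.mem_iff_boolIndicator _ _).1 (hmem.2 rfl)).symm
    | false =>
      have hnot : (false :: xs) ∉ headLang := fun h => Bool.false_ne_true (hmem.1 h)
      exact ((Set.notMem_iff_boolIndicator _ _).1 hnot).symm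

/-- **Non-vacuity (referee rule F1)**: `BPSIZEae s` is inhabited whenever `s ≥ 1` eventually.
[folklore] -/
theorem headLang_mem_BPSIZEae {s : ℕ → ℕ} (h : ∃ n₁ : ℕ, ∀ n ≥ n₁, 1 ≤ s n) :
    headLang ∈ BPSIZEae s := by
  obtain ⟨n₁, hn₁⟩ := h
  exact ⟨headBPFamily, ⟨n₁, fun n hn => (headBPFamily_size_le n).trans (hn₁ n hn)⟩,
    headBPFamily_decides⟩

/-- The empty language is in every `BPSIZEae s` (constant-`false` sinks, size `0`). [folklore] -/
theorem zero_mem_BPSIZEae (s : ℕ → ℕ) : (0 : Language Bool) ∈ BPSIZEae s :=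
  ⟨fun n => BranchingProgram.const n false, ⟨0, fun n _ => by simp⟩, fun x =>
    ((Set.notMem_iff_boolIndicator _ _).1 (show x ∉ (0 : Language Bool) by simp)).symm⟩

end Literature.Computability.MetaComplexity
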